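import Mathlib
import HarnessLib
import HarnessLib.Audit
import Summits.PneNP.Statement
import Literature.Computability.Complexity.ClayProblem
import Literature.Computability.Complexity.TimeBounds
import Literature.Computability.Complexity.BoolEncodings
import Literature.Computability.Complexity.Nondeterministic
import Literature.Computability.Complexity.Classes

/-!
Route: TwoTones

CLOSED (refuted) 2026-08-15T13:22:32Z by planner-PneNP-route-PneNP-TwoTones-0 — reason: refuted:stmt-PneNP-2222 (FrustrationGap) by Summit.PneNP.PneNP.Theorems.TwoTonesFrustrationGap_refuted — note: route-repair seat (planner-PneNP-route-PneNP-TwoTones-0), closing as refuted:FrustrationGap. CENSUS. (1) What the refutation shows: x* = 13/24 = 2/3 + 7/8 - 1 is eventually on BOTH one-tone ground orbits (2^n x* in {1/3,2/3} for n>=3, 3^n x* in {5/8,7/8} for n>=1; 2-adic/3-adic tails decouple by CRT. The file is kept as the record of this route; refuted decls are indexed as negative knowledge (`ledger negatives`).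

It suffices to show X_T [card PneNP/PneNP/two-tones-lacunary-maximum, typed in its triangle-wave
form]: the GROUND-STATE ENERGY OF TWO INCOMMENSURABLE LACUNARY TONES,
  δ_N := min_{x ∈ [0,1]} Σ_{n<N} ( ‖2ⁿx + 1/2‖ + ‖3ⁿx + 1/4‖ ),   ‖t‖ := |t − round t| = dist(t, ℤ),
is NOT computable exactly in time polynomial in N. (δ_N is an explicit rational: D_N(x) :=
Σ_{n<N}(‖2ⁿx+1/2‖ + ‖3ⁿx+1/4‖) is piecewise linear, so its minimum over [0,1] sits at a kink x = (k
− 1/2)/2ⁿ or (k − 1/4)/3ⁿ, n < N, or at an endpoint; "exactly computable" = two polynomial-time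
integer functions a, b of the unary input 1^N with δ_N = a(N)/b(N), the convention of
Literature.Computability.Cryptography.IsPolyTimeComputableReal / Ko1991 Def 2.1.)
Lean (decl GroundStateNotPolyTime; elaborates, planner Sketch.lean rc 0): ¬ ∃ a b : ℕ → ℤ,
PolyTimeComputable unaryEncodeNat encodingIntBool.encode a ∧ PolyTimeComputable unaryEncodeNat
encodingIntBool.encode b ∧ ∀ N, sInf ((fun x : ℝ => ∑ n ∈ Finset.range N, (|2^n*x + 1/2 − round
(2^n*x + 1/2)| + |3^n*x + 1/4 − round (3^n*x + 1/4)|)) '' Set.Icc 0 1) = a N / b N   [constants: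
Literature.Computability.Complexity.PolyTimeComputable (TimeBounds.lean),
Literature.Computability.Complexity.encodingIntBool (BoolEncodings.lean), Mathlib
Computability.unaryEncodeNat, round, sInf].
One tone alone is integrable: for x ↦ 2x the minimising measures of ‖y + 1/2‖ = d(y, 1/2) are
Sturmian (AnagnostopoulouEtAl2012; Bousch2000 for the cosine family; Jenkinson2018 §3, §9) — here
the orbit {1/3, 2/3} with energy 1/6 per step; for x ↦ 3x and ‖y + 1/4‖ the orbit {5/8, 7/8} with
1/8 per step — and each tone's ground state is pessimal for the other (5/8 → 1/4 → 1/2 → 0 under ×2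
lands on the worst 2-phase; 1/3 → 0 under ×3). The thesis bets that the resulting ×2×3 frustration
is computational: every new octave of the 2-tone (scale 2^{−N}) re-frustrates the ternary digits
beyond depth ≈ N·log2/log3, so exact ground states cannot be tracked by refinement.
Assembly (decl Assembly; two layers, glue only): P_bool_eq → NP_bool_eq → KoReduction →
GroundStateNotPolyTime → PneNP, where KoReduction (support item; Ko1982 Thm 7 on this instance: NP ⊆
P ⇒ δ_N exactly polynomial-time, through the tree theorem exists_searchFn_of_NP_subset_P, an exact
rational evaluator in FP and the kink lemma) is the only non-glue hypothesis and the model bridges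
are PROVED tree facts (P_bool_eq_holds, NP_bool_eq_holds). Contrapositive: ¬PneNP gives PNPWave0.NP
Bool ⊆ PNPWave0.P Bool, the bridges transport it to Nondeterministic.NP ⊆ Classes.P, KoReduction
yields a, b, contradicting X_T (the planner's Sketch.lean proves Assembly in ten lines).

Rationale: WHY THIS LINE (widen: ergodic optimisation + ×2×3 rigidity, imported through Ko's real-number
complexity). P = NP decides every P-printable instance family, so hardness of ONE nameable sequence
suffices; Ko1982 (Thm 7: maxima of polynomial-time real functions = NP reals; Thm 14: P_ℝ ≠ NP_ℝ
unless P_S = NP_S, converse open) is the dictionary making "nobody can compute how quiet two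
incommensurable tones can be together" imply P ≠ NP. The object is chosen so that the toy/real split
is theorem-backed: ONE tone = ergodic optimisation for x ↦ 2x with a distance potential, whose
optimisers are Sturmian (AnagnostopoulouEtAl2012, Bousch2000, Jenkinson2018 §3 §9, Contreras2015) —
the integrable rung; TWO tones = one point must make its binary AND ternary orbits simultaneously
structured, which ×2×3 rigidity (Furstenberg1967, Rudolph1990, Shmerkin2019, Wu2019; effective:
BourgainEtAl2009) forbids in the limit, while finitary digit problems of the same family
(Lagarias2009Ternary) are open even to state sharply. Typed variant vs the card: cos/√2/√3 ↦
triangle waves with phases 1/2, 1/4, so δ_N is an exact rational, the NP witness is a kink index,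
evaluation is integer arithmetic (no cosine machines in TM2), and the single-tone answers are
explicit (1/6 on {1/3,2/3}; 1/8 on {5/8,7/8}); every structural theorem cited has its PL form.
Landscape heuristic (motivation only): D_N has the genealogy of a branching random walk on the
binary prefix tree with the 3-tone grafted at depth ratio log3/log2; exact ground states of such
landscapes defeat best-first/greedy search (KarpPearl1983, Aldous1992, Pemantle2009,
AddarioberryMaillard2020) while (1+ε)-energies are greedy-reachable — matching the precision
dichotomy (exact: the thesis; value-PTAS: easy once δ_N/N → e₂₃).
RANKED CRUXES (all typed and elaborating; planner Sketch.lean rc 0; planner exact numerics N ≤ 8 in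
NOTES).
 r2 FrustrationGap — ∃ c > 0, eventually δ_N ≥ δ₂(N) + δ₃(N) + c·N (δ₂, δ₃ = one-tone minima):
frustration is EXTENSIVE; the finitary ×2×3 content of the route (no length-N stretch is near-ground
for both tones). Numerics: gap/N ≈ 0.03–0.06, δ_N/N ≈ 0.31 > 7/24. If false the mechanism dies.
 r3 OneToneSolvable — δ₂(N) IS exactly polynomial-time: the integrable rung as a theorem of
effective ergodic optimisation (finite-horizon Sturmian core + bounded boundary layer, then an FP
implementation). With X_T it makes the one-tone/two-tone contrast a theorem pair.
 r4 GroundStatePolyTime = ¬X_T, staffed so the killing side has provers: an exact polynomial-time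
algorithm (beam search + prefix freezing, lattice/HNP reduction on 3^j·k mod 2^n, joint digit
transfer operator) closes the route and is a result in Diophantine computation either way.
 Support: OneToneEnergies (|δ₂(N) − N/6|, |δ₃(N) − N/8| bounded; sub-action certificates, provable
now), KoReduction (Ko's reduction on this instance over the tree's FP toolkit +
exists_searchFn_of_NP_subset_P; provable now, ~1–2 kLoC), Assembly (glue; proved in the sketch).
KILL CRITERIA. (i) Cheap kit experiment (card): branch-and-bound δ_N for N ≤ 30 with the
lexicographically least minimiser x_N; statistic L(N) = common binary prefix length of x_N and
x_{N+1}. Prefix freezing L(N) ≥ N − O(log N), or B&B trees of polynomial size ⇒ refinement is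
plausibly exact ⇒ retire; the route predicts L(N) ≈ 0.63·N with macroscopic ternary reshuffles (seen
already at N = 6,7,8: ternary digit 5 flips). (ii) r4 proved. (iii) r2 refuted for (1/2, 1/4):
restate ONCE with other dyadic/triadic phases only if the refutation is a phase coincidence, else
close. (iv) A theorem putting all Ko-type NP reals of lacunary-sum form in P_ℝ (none known;
TsitsiklisBlondel1997-type hardness points the other way, for instance-given data only).
CALIBRATION (honest). X_T sits at Ko's P_ℝ ≠ NP_ℝ layer: it implies P ≠ NP (Assembly) and is implied
by nothing known; Ko1982 Thm 14 derives intractable NP reals from P_S ≠ NP_S (tally; Book1974,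
HartmanisImmermanSewelson1985), converse open — no E ≠ NE bookkeeping is claimed (the card's was
loose; its audit agreed). No technique for a uniform time lower bound on a fixed NP real exists; the
unconditional deliverables are r2 (a finitary ×2×3 rigidity theorem), r3 (effective Sturmian
optimisation), the supports, and data.
NOT DECOMPOSED YET: the 3-tone analogue of r3; existence and value of e₂₃ = lim δ_N/N; a search-PTAS
statement (needs joint periodic specification, obstructed by gcd(2ⁿ−1, 3ⁿ−1) = exp(o(n)),
BugeaudCorvajaZannier2003); an overlap-gap / refrustration-depth statement (L(N) ≤ 0.64·N infinitely
often); the card's cos/√2,√3 parent object (same mechanism; needs uniform polynomial-time cosine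
evaluation in TM2). Prior programme: not consulted (plancard mode). NOVELTY and BARRIERS: dedicated
header sections.

Novelty: NOVELTY (search-before-claim: card 2026-08-15, its audit, and this session). Nearest prior art
FOUND: [A] the Assembly is Ko's theory of NP real numbers — Ko1982
(doi:10.1016/0022-0000(82)90053-8; held, read pp. 6, 12, 17–18: Thm 7 max of a polynomial-time real
function ↔ left NP real; Thm 14 P_ℝ ≠ NP_ℝ unless P_S = NP_S, converse open; Thm 15 a Ladner-type
set above all NP left cuts), KoFriedman1982 (doi:10.1016/S0304-3975(82)80003-0), Ko1991 ch. 3;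
packaging one instance sequence on unary inputs is standard, so X_T is an INSTANCE of Ko's P_ℝ vs
NP_ℝ question (audit). [B] one-tone integrability: AnagnostopoulouEtAl2012
(doi:10.1007/s00574-012-0013-3, Sturmian maximising measures for u_θ = −d(x,θ) under x ↦ 2x —
paywalled, acq-02094; content confirmed through Jenkinson2018 §9, held and read), Bousch2000
(doi:10.1016/S0246-0203(00)00132-1, cosine family), HuntOtt1996, Contreras2015, Jenkinson2006; the
finite-dimensional reformulation of such problems is a maximum-cycle-mean problem (Jenkinson2018
§7). [C] frustration side: Furstenberg1967, Rudolph1990, Shmerkin2019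
(doi:10.4007/annals.2019.189.2.1) and Wu2019 (doi:10.4007/annals.2019.189.3.2) bound DIMENSIONS of
intersections of ×2- and ×3-invariant sets; BourgainEtAl2009 (effective ×a×b density);
Lagarias2009Ternary (doi:10.1112/jlms/jdn080: ternary digits of 2ⁿ — finitary ×2×3 statements are
open); BugeaudCorvajaZannier2003 (gcd(2ⁿ−1,3ⁿ−1) subexponential: no joint periodic structure). [D]
'ergodic optimisation meets computat  [refs: 10.1016/0022-0000(82, 10.1016/S0304-3975(82, 10.1007/s00574-012-0013-3, 10.1016/S0246-0203(00, 10.4007/annals.2019.189.2.1, 10.4007/annals.2019.189.3.2, 10.1112/jlms/jdn080:, 10.1007/bf01219774:, 10.1137/0214016:, 10.1007/bf01219774, 10.1109/9.880644, 1712.02307, doi:10.1016/0022-0000, doi:10.1016/S0304-3975, doi:10.1007/s00574-012-0013-3, doi:10.1016/S0246-0203, doi:10.4007/annals.2019.189.2.1, d]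

Barriers (technique_class: tally-np-thesis, ergodic-optimisation, x2x3-rigidity): technique_class: tally-np-thesis, ergodic-optimisation, x2x3-rigidity
- Literature.Barriers.PneNP.Relativization (with Literature.Barriers.PneNP.BoundedRelativization and
Literature.Barriers.PneNP.Algebrization): APPLY at thesis level and are relocated, not evaded. The
Assembly relativizes: relative to a PSPACE-complete oracle A one has NP^A ⊆ P^A, KoReduction^A then
makes δ_N computable by a P^A machine and X_T^A fails, while relative to a separating oracle the
real-world X_T is untouched — so any proof of X_T is non-relativizing, non-PSPACE-relativizing and
non-algebrizing. The route names no non-relativizing ingredient for X_T itself; the bet is that a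
statement about ONE explicit arithmetic optimisation problem is decided by Diophantine / ×2×3
structure (cruxes FrustrationGap, OneToneSolvable, and whatever refutes or survives
GroundStatePolyTime) that oracle arguments do not see. Honest status: it does not evade them.
- Literature.Barriers.PneNP.RelativizationNarrow: bookkeeping only — X_T concerns a P-printable
(unary-indexed) instance family, i.e. the tally end of the summit; the narrow entry records that
over tally/sparse oracles the Baker–Gill–Solovay no-go against P ≠ NP disappears unless NP ⊆ P/poly,
and that P = NP ↔ ∀ tally T, P^T = NP^T (LongSelman1986). Nothing in the route contradicts or uses
this; it says tally-flavoured theses are not where relativization bites hardest, no more.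
- Literature.Barriers.PneNP.NaturalProofs: not applicable in form — no circuit lo

History (route lifecycle, newest last):
- 2026-08-15T13:01:17Z · BROKEN — FrustrationGap (stmt-PneNP-2222, crux) refuted by Summit.PneNP.PneNP.Theorems.TwoTonesFrustrationGap_refuted @ 496b0360f1d8 (refuter-rreview-route-QuantumAdvantage-C-a3b0799b-0)
- 2026-08-15T13:22:33Z · CLOSED refuted — refuted:stmt-PneNP-2222 (FrustrationGap) by Summit.PneNP.PneNP.Theorems.TwoTonesFrustrationGap_refuted (planner-PneNP-route-PneNP-TwoTones-0)

sub-problem: PneNP · status: closed(refuted) · opened planner-plancard-PneNP-PneNP-two-tones-lacuna-10a48f23-0 2026-08-15T11:02:26Z · rev 0 · ledger route-PneNP-TwoTones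
GENERATED by the gate from the ledger (D-0016/17). Provers cite these decls: `theorem foo : Summit.PneNP.PneNP.Theses.TwoTones.<Decl> := …` in Summits/PneNP/PneNP/Theorems/<Name>.lean.
-/

namespace Summit.PneNP.PneNP.Theses.TwoTones

open scoped BigOperators Topology Manifold Classical MeasureTheory ProbabilityTheory Matrix InnerProductSpace ComplexConjugate ContinuousMap
open Filter Set Function TopologicalSpace MeasureTheory

attribute [summit_statement] _root_.PneNP

open Literature.PNP

/-- item stmt-PneNP-2221 · target · rank 0 · closed · moot by None · by planner
why it might fail: Minimisers x_N may freeze their binary/ternary prefixes (L(N) >= N - O(log N)), making greedy refinement exact in polynomial time; or 3^j*k mod 2^n may yield to lattice reduction (hidden-number style). The cheap kit test N <= 30 decides the first.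
sources: Ko1982, KoFriedman1982, Ko1991, Lagarias1985, KarpPearl1983
[target] X_T of route TwoTones (card two-tones-lacunary-maximum, triangle-wave form). delta_N := min
over x in [0,1] of sum_{n<N} (||2^n x + 1/2|| + ||3^n x + 1/4||), ||t|| = |t - round t| = dist(t,Z);
delta_N is rational (D_N piecewise linear: minimum at a kink (k-1/2)/2^n or (k-1/4)/3^n, n<N, or an
endpoint). CLAIM: no polynomial-time (in N; unary input 1^N, integer output in encodingIntBool — the
convention of IsPolyTimeComputableReal / Ko1991 Def 2.1) integer functions a, b satisfy delta_N =
a(N)/b(N) for all N. Exact form = the weakest natural thesis (a Ko-style dyadic approximation to 5N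
bits recovers delta_N by rational reconstruction, denominators divide 4*6^N; constant relative
precision is presumably easy, as delta_N/N should converge). Implies P != NP via Assembly; sits at
Ko1982's P_R vs NP_R layer (Thm 14: P_S != NP_S => P_R != NP_R, converse open) — no E != NE claim.
Kill test (rationale (i)): prefix-freezing statistic L(N) of lexicographically least minimisers for
N <= 30. -/
@[route_item "route-PneNP-TwoTones"]
def GroundStateNotPolyTime : Prop :=
  ¬ ∃ a b : ℕ → ℤ, Literature.Computability.Complexity.PolyTimeComputable Computability.unaryEncodeNat Literature.Computability.Complexity.encodingIntBool.encode a ∧ Literature.Computability.Complexity.PolyTimeComputable Computability.unaryEncodeNat Literature.Computability.Complexity.encodingIntBool.encode b ∧ ∀ N : ℕ, sInf ((fun x : ℝ => ∑ n ∈ Finset.range N, (|2 ^ n * x + 1 / 2 - round (2 ^ n * x + 1 / 2)| + |3 ^ n * x + 1 / 4 - round (3 ^ n * x + 1 / 4)|)) '' Set.Icc (0 : ℝ) 1) = (a N : ℝ) / (b N : ℝ)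

/-- item stmt-PneNP-2222 · crux · rank 2 · closed · refuted by Summit.PneNP.PneNP.Theorems.TwoTonesFrustrationGap_refuted @ 496b0360f1d8 (refuter) · by planner
why it might fail: For (1/2,1/4) arbitrarily long jointly near-ground stretches might exist (x agreeing with k/(3*2^j) on blocks while 3^i*k' mod 2^j hugs the arc at 3/4): a finitary x2x3 coincidence current tools neither exclude nor exhibit (Shmerkin/Wu give dimension, not emptiness); then delta_N = 7N/24 + o(N).
sources: Furstenberg1967, Rudolph1990, Shmerkin2019, Wu2019, BourgainEtAl2009, Lagarias2009Ternary
[crux r2] EXTENSIVE x2x3 frustration for the phases (1/2, 1/4): exists c > 0 and N0 with delta_N >=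
delta2(N) + delta3(N) + c*N for all N >= N0, where delta2(N) = min_x sum_{n<N} ||2^n x + 1/2|| and
delta3(N) = min_x sum_{n<N} ||3^n x + 1/4|| are the one-tone ground energies (= N/6 + O(1) and N/8 +
O(1) by OneToneEnergies, ground orbits {1/3,2/3} and {5/8,7/8}). Says: no x has a length-N binary
orbit shadowing {1/3,2/3} AND a length-N ternary orbit shadowing {5/8,7/8} up to o(N) total defect —
a FINITARY transversality of thin x2- and x3-structured sets (Shmerkin2019 / Wu2019 bound the
DIMENSION of such intersections, not finite-scale emptiness; Lagarias2009Ternary shows how hard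
finitary x2x3 digit statements are). Planner numerics (exact, N <= 8): (delta_N - delta2 - delta3)/N
in [0.014, 0.06], delta_N/N ~ 0.31 > 7/24. Plausible proof shape: 2-near-ground blocks force x to
agree with k/(3*2^j) on long stretches, reducing the 3-tone to the distribution of 3^i*k' mod 2^j in
the arc around 3/4 — small powers of 3 modulo powers of 2 (effective tools: BourgainEtAl2009). The
route's unconditional x2x3 deliverable; if FALSE the mechanism dies (kill criterion (iii)). -/
@[route_item "route-PneNP-TwoTones"]
def FrustrationGap : Prop :=
  ∃ c : ℝ, 0 < c ∧ ∃ N₀ : ℕ, ∀ N ≥ N₀, sInf ((fun x : ℝ => ∑ n ∈ Finset.range N, (|2 ^ n * x + 1 / 2 - round (2 ^ n * x + 1 / 2)| + |3 ^ n * x + 1 / 4 - round (3 ^ n * x + 1 / 4)|)) '' Set.Icc (0 : ℝ) 1) ≥ sInf ((fun x : ℝ => ∑ n ∈ Finset.range N, |2 ^ n * x + 1 / 2 - round (2 ^ n * x + 1 / 2)|) '' Set.Icc (0 : ℝ) 1) + sInf ((fun x : ℝ => ∑ n ∈ Finset.range N, |3 ^ n * x + 1 / 4 - round (3 ^ n *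 x + 1 / 4)|) '' Set.Icc (0 : ℝ) 1) + c * (N : ℝ)

/-- item stmt-PneNP-2223 · crux · rank 3 · closed · moot by None · by planner
why it might fail: Exact finite-horizon optimisers need a turnpike theorem (Sturmian core + bounded end layer); if end layers grow with N or optimal kinks proliferate, exact delta2(N) may require super-polynomially many candidates, leaving only quasi-polynomial or fixed-precision versions true.
sources: AnagnostopoulouEtAl2012, Bousch2000, Jenkinson2018, Contreras2015, HuntOtt1996
[crux r3] The INTEGRABLE RUNG as a theorem: the one-tone ground energy delta2(N) = min_{x in [0,1]}
sum_{n<N} ||2^n x + 1/2|| is EXACTLY polynomial-time computable (exists poly-time a, b : N -> Z on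
unary input with delta2(N) = a(N)/b(N)). Infinite horizon: the minimising measures of y -> ||y +
1/2|| = d(y, 1/2) under x -> 2x are Sturmian (AnagnostopoulouEtAl2012, via Jenkinson2018 sec. 9;
Bousch2000 for cos), here {1/3,2/3} with energy 1/6, certified by the sub-action u(y) =
-dist(y,{1/3,2/3}). Finite horizon: optimal orbit segments = Sturmian core + a boundary layer at the
END (late binary digits are free: delta2(2) = 1/4 at x = 1/4, delta2(3) = 3/8 at 3/8, delta2(4) =
9/16 at 5/16); the claim needs that layer / the candidate set to stay polynomial (a turnpike theorem
for the doubling map; cf. Bousch's orbit-locking bound, Jenkinson2018 Prop 7.9) and then an FP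
implementation over the tree's integer bricks (PolyTimeComputableReals.lean, CodeFPArith). Contrast
with the target: for ONE base, precision eps costs N*poly(1/eps) by maximum-cycle-mean on a de
Bruijn window graph (Jenkinson2018 sec. 7); exactness is where Sturmian structure is needed, and for
TWO bases no window graph ex -/
@[route_item "route-PneNP-TwoTones"]
def OneToneSolvable : Prop :=
  ∃ a b : ℕ → ℤ, Literature.Computability.Complexity.PolyTimeComputable Computability.unaryEncodeNat Literature.Computability.Complexity.encodingIntBool.encode a ∧ Literature.Computability.Complexity.PolyTimeComputable Computability.unaryEncodeNat Literature.Computability.Complexity.encodingIntBool.encode b ∧ ∀ N : ℕ, sInf ((fun x : ℝ => ∑ n ∈ Finset.range N, |2 ^ n * x + 1 / 2 - round (2 ^ n * x + 1 / 2)|) '' Set.Icc (0 : ℝ) 1) = (a N : ℝ) / (b N : ℝ)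

/-- item stmt-PneNP-2224 · crux · rank 4 · closed · moot by None · by planner
why it might fail: Believed FALSE (it is not-X_T): HNP/LLL attacks need planted o(1) errors but ground-state defects are Theta(1) per term; x3 is not local on binary digits, so digit DP has exponential state; best-first search on BRW-like landscapes is exponential (KarpPearl1983). Lean needs an explicit TM2 witness.
sources: Lagarias1985, BonehVenkatesan1996, KarpPearl1983, Pemantle2009, Ko1982
[crux r4, NEGATIVE side = not X_T, filed so the killing side has provers] exists polynomial-time a,
b : N -> Z (unary input, encodingIntBool output) with delta_N = a(N)/b(N) for all N. Candidate
attacks, each a result in Diophantine computation if it works: (a) greedy/beam refinement plus a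
provable prefix-freezing lemma (L(N) >= N - O(log N)); (b) lattice reduction on the rank-one lattice
{(k, 3k, ..., 3^{N-1}k) mod 2^n} in hidden-number-problem style (BonehVenkatesan1996 — those need
planted o(1) errors; here per-term defects are Theta(1)); (c) a transfer operator on a joint
(2,3)-adic digit system. Lagarias1985 (NP-hardness of simultaneous Diophantine approximation for
GIVEN data) is the cautionary neighbour, not an obstruction for this fixed family. Proving it closes
route TwoTones (kill criterion (ii)); refuters may instead attack the target directly. -/
@[route_item "route-PneNP-TwoTones"]
def GroundStatePolyTime : Prop :=
  ∃ a b : ℕ → ℤ, Literature.Computability.Complexity.PolyTimeComputable Computability.unaryEncodeNat Literature.Computability.Complexity.encodingIntBool.encode a ∧ Literature.Computability.Complexity.PolyTimeComputable Computability.unaryEncodeNat Literature.Computability.Complexity.encodingIntBool.encode b ∧ ∀ N : ℕ, sInf ((fun x : ℝ => ∑ n ∈ Finset.range N, (|2 ^ n * x + 1 / 2 - round (2 ^ n * x + 1 / 2)| + |3 ^ n * x + 1 / 4 - round (3 ^ n * x + 1 / 4)|)) '' Set.Icc (0 : ℝ) 1) = (a N : ℝ) / (b N : ℝ)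

/-- item stmt-PneNP-2225 · support · rank 9 · closed · moot by None · by planner
sources: AnagnostopoulouEtAl2012, Jenkinson2018, Bousch2000
[support] One-tone ground energies up to O(1): exists C, for all N, |delta2(N) - N/6| <= C and
|delta3(N) - N/8| <= C, with delta2(N) = min_x sum_{n<N} ||2^n x + 1/2||, delta3(N) = min_x
sum_{n<N} ||3^n x + 1/4|| (sInf of the image of [0,1]). Upper bounds: x = 1/3 gives exactly N/6
(every term 1/6); x = 7/8 gives N/8 (orbit 7/8 <-> 5/8 under x3, every term 1/8). Lower bounds by
sub-actions (revelations, Jenkinson2018 sec. 5-6): bounded u2, u3 with ||y+1/2|| - 1/6 >= u2(2y) -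
u2(y) and ||y+1/4|| - 1/8 >= u3(3y) - u3(y) on R/Z, then telescope; planner's candidate u2(y) =
-dist(y,{1/3,2/3}) checks at sampled points with equality on large sets, u3 = -c*dist(y,{5/8,7/8})
to be tuned. Elementary PL case analysis (AnagnostopoulouEtAl2012 guarantees Sturmian optimisers for
x2). Turns FrustrationGap into liminf delta_N/N > 7/24 and calibrates the kit experiment.
Bookkeeping: sInf needs the image nonempty and bounded below (continuous on Icc). -/
@[route_item "route-PneNP-TwoTones"]
def OneToneEnergies : Prop :=
  ∃ C : ℝ, ∀ N : ℕ, |sInf ((fun x : ℝ => ∑ n ∈ Finset.range N, |2 ^ n * x + 1 / 2 - round (2 ^ n * x + 1 / 2)|) '' Set.Icc (0 : ℝ) 1) - (N : ℝ) / 6| ≤ C ∧ |sInf ((fun x : ℝ => ∑ n ∈ Finset.range N, |3 ^ n * x + 1 / 4 - round (3 ^ n * x + 1 / 4)|) '' Set.Icc (0 : ℝ) 1) - (N : ℝ) / 8| ≤ C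

/-- item stmt-PneNP-2226 · support · rank 9 · closed · moot by None · by planner
sources: Ko1982, KoFriedman1982, AroraBarakCC2009
[support, LOAD-BEARING in Assembly; Ko1982 Thm 7 / KoFriedman1982 on this instance — known in print,
to be built in the tree] Nondeterministic.NP ⊆ Classes.P -> exists poly-time a, b : N -> Z
(unaryEncodeNat -> encodingIntBool) with delta_N = a(N)/b(N). Plan over the tree's toolkit: (1) kink
lemma: D_N is piecewise linear on [0,1], so sInf (D_N '' Icc 0 1) = min over <= 2(2^N + 3^N) + 2
candidates x = (k-1/2)/2^n, (k-1/4)/3^n (n < N), 0, 1 — witnesses w of O(N) bits; (2) exact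
evaluator E in FP: <1^N, w> -> numerator of D_N(x_w) over the common denominator 4*6^N (integer
bricks of PolyTimeComputableReals.lean / CodeFPArith: add, multiply by 2 and 3, compare, min(r,
d-r)); (3) the optimality relation R = {<1^N, w> : w candidate and for all candidates w', E(w) <=
E(w')} is polyForall of a P-relation, i.e. coNP, hence in P under NP ⊆ P (co_P_holds,
P_subset_NP_holds, mem_polyForall_iff); (4) exists_searchFn_of_NP_subset_P (SearchToDecision.lean)
applied to R yields an optimal w* as an FP function of 1^N; (5) a := E o w*, b := 4*6^N, re-indexed
along unaryEncodeNat (polyTimeComputable_of_nameFn, PolyTimeComputable.comp_holds). Alternative to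
(3)-(4): binary search over thresholds with -/
@[route_item "route-PneNP-TwoTones"]
def KoReduction : Prop :=
  Literature.Computability.Complexity.Nondeterministic.NP ⊆ Literature.Computability.Complexity.Classes.P → ∃ a b : ℕ → ℤ, Literature.Computability.Complexity.PolyTimeComputable Computability.unaryEncodeNat Literature.Computability.Complexity.encodingIntBool.encode a ∧ Literature.Computability.Complexity.PolyTimeComputable Computability.unaryEncodeNat Literature.Computability.Complexity.encodingIntBool.encode b ∧ ∀ N : ℕ, sInf ((fun x : ℝ => ∑ n ∈ Finset.range N, (|2 ^ n * x + 1 / 2 - round (2 ^ n * x + 1 / 2)| + |3 ^ n * x + 1 / 4 - round (3 ^ n * x + 1 / 4)|)) '' Set.Icc (0 : ℝ) 1) = (a N : ℝ) / (b N : ℝ)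

/-- item stmt-PneNP-2227 · assembly · rank 1 · closed · moot by None · by planner
sources: Ko1982, AroraBarakCC2009
[assembly] P_bool_eq -> NP_bool_eq -> KoReduction -> GroundStateNotPolyTime -> PneNP. Glue only (the
planner's Sketch.lean proves it in ten lines): assume not PneNP, i.e. every L in PNPWave0.NP Bool
lies in PNPWave0.P Bool; rewrite with the bridges (both PROVED tree facts: P_bool_eq_holds in
ClayProblem.lean, NP_bool_eq_holds in ClayProblemProofs.lean) to get Nondeterministic.NP ⊆
Classes.P; KoReduction gives poly-time a, b with delta_N = a N / b N, contradicting the target. All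
mathematical weight sits in KoReduction (support, provable now) and in the target. -/
@[route_item "route-PneNP-TwoTones"]
def Assembly : Prop :=
  Literature.Computability.Complexity.P_bool_eq → Literature.Computability.Complexity.NP_bool_eq → KoReduction → GroundStateNotPolyTime → PneNP

end Summit.PneNP.PneNP.Theses.TwoTones
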